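import Summits.ABC.ABC.Theorems.TwistAmplificationSharpModerateLawDefs
import Literature.NumberTheory.CubicFields.MaximalOverring
import Literature.NumberTheory.CubicFields.MaximalDiscriminantValuation
import Mathlib.Analysis.Complex.Polynomial.Basic

/-!
# Crux `TwistAmplification.SharpModerateLaw` (stmt-ABC-1975), line `unit-plane-conic-two-torsion`:
the inverse dictionary `CoreLaw → CoreLawIF`, I — fibres of `(D, O, q) ↦ (H_F(q), G_F(q))`

Support file (`--supports stmt-ABC-1975`, stub `stub_ringCensus`, wave 2; the stub itself stays open), first of three
(`…CoreInverseDictionaryFibres.lean`, `…CoreInverseDictionaryDescaling.lean`, `…CoreInverseDictionary.lean`) proving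
the inverse dictionary `coreLawIF_of_coreLaw : CoreLaw → CoreLawIF` between the lead's Szpiro-robust cores
(`…SharpModerateLawCoreDefs.lean`).  This file bounds the FIBRES of the map from index-form data `(D, O, q)`
(`F = orbitRep O` maximal) to the covariant values `(H, G) = (H_F(q), G_F(q))` (`hessAt`, `covAt` of `…Defs.lean`):

* `eta_charpoly` — the trace-zero element `η_q = 3(q.1·ω + q.2·θ) − (b·q.1 − c·q.2) ∈ R(F)` satisfies
  `η_q³ − 3H·η_q − G = 0` (Cayley–Hamilton for `q.1·ω + q.2·θ`, shifted and scaled);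
* `exists_ringHom_of_datum` — `ω ↦ η_q`, `θ ↦ 3H − η_q²` is an injective ring homomorphism
  `R(1, 0, −3H, G) ↪ R(F)` whenever `F(q) ≠ 0` (the index of `ℤ[η_q]` is `27|F(q)|`); `disc_normalForm_datum`:
  `Disc(1, 0, −3H, G) = 729·Disc F·F(q)²`;
* `sigma_eq_of_data` — two MAXIMAL orbit representatives carrying data with the same `(H, G)` receive the same
  `R(1, 0, −3H, G)` injectively, hence are `GL₂(ℤ)`-equivalent (`RingOfForm.gl2zEquiv_of_isMaximal_overrings`,
  Literature `MaximalOverring.lean`): the same orbit of the same discriminant;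
* `roots_finite_ringOfForm` — `T³ + cT + d` has at most `27` roots in a maximal `R(F)`: a domain for irreducible `F`
  (`≤ 3`, `Cubic.card_roots_le`), and `≅ ℤ × ℤ[t]/(t² + c't + d')` with `c'² − 4d' = Disc F ≠ 0` for reducible maximal
  `F` (`RingOfForm.exists_ringEquiv_prod_quadraticAlgebra`), whose quadratic factor embeds into `ℂ²` through its two
  complex roots (`exists_two_ringHom_quadraticAlgebra`);
* `ncard_data_le`, **`data_fibre_le`** (registered sub-goal) — for `F` maximal and `(H, G)` fixed at most `27` data
  `q` have `(H_F(q), G_F(q)) = (H, G)` (`q ↦ η_q` is injective into the roots of `T³ − 3HT − G`).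
-/

noncomputable section

-- the mandated summit namespace `Summit.ABC.ABC` (summit = problem) trips the duplicate-namespace linter
set_option linter.dupNamespace false

namespace Summit.ABC.ABC.Theorems.SharpModerateLaw

open Literature.NumberTheory.CubicFields BinaryCubic
open scoped BigOperators

/-! ## 1. Roots of a monic cubic `T³ + cT + d` in a maximal cubic ring: at most `27` -/

/-- In an integral domain `T³ + cT + d` has at most `3` roots. -/
theorem roots_finite_of_isDomain {R : Type*} [CommRing R] [IsDomain R] (c d : R) :
    {η : R | η ^ 3 + c * η + d = 0}.Finite ∧ {η : R | η ^ 3 + c * η + d = 0}.ncard ≤ 3 := by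
  classical
  let P : Cubic R := ⟨1, 0, c, d⟩
  have h0 : P.toPoly ≠ 0 := Cubic.ne_zero_of_a_ne_zero one_ne_zero
  have hsub : {η : R | η ^ 3 + c * η + d = 0} ⊆ (P.roots.toFinset : Set R) := by
    intro η hη
    rw [Finset.mem_coe, Multiset.mem_toFinset, Cubic.mem_roots_iff h0]
    simp only [P, one_mul, zero_mul, add_zero]
    exact hη
  exact ⟨(Finset.finite_toSet _).subset hsub,
    (Set.ncard_le_ncard hsub (Finset.finite_toSet _)).trans (by rw [Set.ncard_coe_finset]; exact Cubic.card_roots_le)⟩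

/-- Two ring homomorphisms `ℤ ⊕ ℤ·t → ℂ` (`t² = a' + b't`, at the two complex roots), jointly injective when
`b'² + 4a' ≠ 0`. -/
theorem exists_two_ringHom_quadraticAlgebra {a' b' : ℤ} (hD : b' ^ 2 + 4 * a' ≠ 0) :
    ∃ π₁ π₂ : QuadraticAlgebra ℤ a' b' →+* ℂ, ∀ z w, π₁ z = π₁ w → π₂ z = π₂ w → z = w := by
  obtain ⟨σ, hσ⟩ := IsAlgClosed.exists_pow_nat_eq ((b' : ℂ) ^ 2 + 4 * a') two_pos
  have hσ0 : σ ≠ 0 := by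
    rintro rfl
    apply hD
    have h : ((b' ^ 2 + 4 * a' : ℤ) : ℂ) = 0 := by push_cast; rw [← hσ]; norm_num
    exact_mod_cast h
  have hr : ∀ r : ℂ, (r = ((b' : ℂ) + σ) / 2 ∨ r = ((b' : ℂ) - σ) / 2) → r * r = a' • (1 : ℂ) + b' • r := by
    rintro r (rfl | rfl) <;> simp only [zsmul_eq_mul, mul_one] <;> linear_combination (1 / 4 : ℂ) * hσ
  let π₁ : QuadraticAlgebra ℤ a' b' →+* ℂ := (QuadraticAlgebra.lift ⟨_, hr _ (Or.inl rfl)⟩).toRingHom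
  let π₂ : QuadraticAlgebra ℤ a' b' →+* ℂ := (QuadraticAlgebra.lift ⟨_, hr _ (Or.inr rfl)⟩).toRingHom
  have e₁ : ∀ z : QuadraticAlgebra ℤ a' b', π₁ z = (z.re : ℂ) + (z.im : ℂ) * (((b' : ℂ) + σ) / 2) := fun z => by
    simp [π₁, zsmul_eq_mul]
  have e₂ : ∀ z : QuadraticAlgebra ℤ a' b', π₂ z = (z.re : ℂ) + (z.im : ℂ) * (((b' : ℂ) - σ) / 2) := fun z => by
    simp [π₂, zsmul_eq_mul]
  refine ⟨π₁, π₂, fun z w h1 h2 => ?_⟩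
  rw [e₁, e₁] at h1
  rw [e₂, e₂] at h2
  have him : ((z.im : ℂ) - w.im) * σ = 0 := by linear_combination h1 - h2
  have him' : (z.im : ℂ) = w.im := by
    have := (mul_eq_zero.mp him).resolve_right hσ0
    linear_combination this
  have hre : (z.re : ℂ) = w.re := by rw [him'] at h1; linear_combination h1
  ext
  · exact_mod_cast hre
  · exact_mod_cast him'

/-- In `ℤ × (ℤ ⊕ ℤ·t)` (`t² = a' + b't`, `b'² + 4a' ≠ 0`) the cubic `T³ + cT + d` has at most `27` roots
(componentwise, through the two complex embeddings of the quadratic factor). -/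
theorem roots_finite_prod_quadraticAlgebra {a' b' : ℤ} (hD : b' ^ 2 + 4 * a' ≠ 0) (c d : ℤ) :
    {η : ℤ × QuadraticAlgebra ℤ a' b' | η ^ 3 + (c : ℤ × QuadraticAlgebra ℤ a' b') * η + (d : _) = 0}.Finite ∧
    {η : ℤ × QuadraticAlgebra ℤ a' b' | η ^ 3 + (c : ℤ × QuadraticAlgebra ℤ a' b') * η + (d : _) = 0}.ncard ≤ 27 := by
  obtain ⟨π₁, π₂, hπ⟩ := exists_two_ringHom_quadraticAlgebra hD
  set S := {η : ℤ × QuadraticAlgebra ℤ a' b' | η ^ 3 + (c : ℤ × QuadraticAlgebra ℤ a' b') * η + (d : _) = 0}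
  obtain ⟨hZf, hZ⟩ := roots_finite_of_isDomain (c : ℤ) d
  obtain ⟨hCf, hC⟩ := roots_finite_of_isDomain (c : ℂ) d
  set T := {n : ℤ | n ^ 3 + c * n + d = 0} ×ˢ ({z : ℂ | z ^ 3 + (c : ℂ) * z + d = 0} ×ˢ {z : ℂ | z ^ 3 + (c : ℂ) * z + d = 0})
  have hTf : T.Finite := hZf.prod (hCf.prod hCf)
  let g : ℤ × QuadraticAlgebra ℤ a' b' → ℤ × ℂ × ℂ := fun η => (η.1, π₁ η.2, π₂ η.2)
  have hmaps : ∀ η ∈ S, g η ∈ T := by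
    intro η hη
    have h1 : η.1 ^ 3 + c * η.1 + d = 0 := by simpa using congrArg Prod.fst hη
    have h2 : η.2 ^ 3 + (c : QuadraticAlgebra ℤ a' b') * η.2 + d = 0 := by simpa using congrArg Prod.snd hη
    refine ⟨h1, ?_, ?_⟩
    · have := congrArg π₁ h2
      simpa using this
    · have := congrArg π₂ h2
      simpa using this
  have hinj : Set.InjOn g S := by
    intro η _ η' _ h
    simp only [g, Prod.mk.injEq] at h
    exact Prod.ext h.1 (hπ _ _ h.2.1 h.2.2)
  have hT : T.ncard ≤ 27 := by
    rw [Set.ncard_prod, Set.ncard_prod]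
    calc _ ≤ 3 * (3 * 3) := Nat.mul_le_mul hZ (Nat.mul_le_mul hC hC)
      _ = 27 := by norm_num
  exact ⟨Set.Finite.of_finite_image (hTf.subset (Set.image_subset_iff.mpr hmaps)) hinj,
    (Set.ncard_le_ncard_of_injOn g hmaps hinj hTf).trans hT⟩

/-- **At most `27` roots of `T³ + cT + d` in a maximal cubic ring** `R(F)`: a domain if `F` is irreducible
(`≤ 3`), else `≅ ℤ × ℤ[t]/(t² + c't + d')` with `c'² − 4d' = Disc F ≠ 0` (`RingOfForm.exists_ringEquiv_prod_quadraticAlgebra`). -/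
theorem roots_finite_ringOfForm {F : BinaryCubic ℤ} (hF : RingOfForm.IsMaximal F) (c d : ℤ) :
    {η : RingOfForm F | η ^ 3 + (c : RingOfForm F) * η + (d : RingOfForm F) = 0}.Finite ∧
    {η : RingOfForm F | η ^ 3 + (c : RingOfForm F) * η + (d : RingOfForm F) = 0}.ncard ≤ 27 := by
  by_cases hirr : F.IsIrreducible
  · haveI := RingOfForm.isDomain_of_isIrreducible hirr
    obtain ⟨hfin, h3⟩ := roots_finite_of_isDomain (c : RingOfForm F) d
    exact ⟨hfin, h3.trans (by norm_num)⟩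
  · obtain ⟨c', d', -, hdisc, ⟨e⟩⟩ :=
      RingOfForm.exists_ringEquiv_prod_quadraticAlgebra hF hirr hF.disc_ne_zero
    have hD : (-c') ^ 2 + 4 * (-d') ≠ 0 := by
      rw [show (-c') ^ 2 + 4 * (-d') = c' ^ 2 - 4 * d' by ring, ← hdisc]; exact hF.disc_ne_zero
    obtain ⟨hfin, h27⟩ := roots_finite_prod_quadraticAlgebra hD c d
    have hmaps : ∀ η ∈ {η : RingOfForm F | η ^ 3 + (c : RingOfForm F) * η + (d : RingOfForm F) = 0},
        e η ∈ {η : ℤ × QuadraticAlgebra ℤ (-d') (-c') |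
          η ^ 3 + (c : ℤ × QuadraticAlgebra ℤ (-d') (-c')) * η + (d : _) = 0} := by
      intro η hη
      have := congrArg e hη
      simpa using this
    have hinj : Set.InjOn e {η : RingOfForm F | η ^ 3 + (c : RingOfForm F) * η + (d : RingOfForm F) = 0} :=
      e.injective.injOn
    exact ⟨Set.Finite.of_finite_image (hfin.subset (Set.image_subset_iff.mpr hmaps)) hinj,
      (Set.ncard_le_ncard_of_injOn e hmaps hinj hfin).trans h27⟩

/-! ## 2. The trace-zero generator `η_q` and the embedding `R(1, 0, −3H, G) ↪ R(F)` -/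

/-- **Cayley–Hamilton for `η_q = 3(uω + vθ) − (bu − cv)`**: `η_q³ − 3H_F(u,v)·η_q − G_F(u,v) = 0` in `R(F)`. -/
theorem eta_charpoly (F : BinaryCubic ℤ) (u v : ℤ) :
    (⟨-(F.b * u - F.c * v), 3 * u, 3 * v⟩ : RingOfForm F) ^ 3
      + ((-3 * hessAt F u v : ℤ) : RingOfForm F) * ⟨-(F.b * u - F.c * v), 3 * u, 3 * v⟩
      + ((-covAt F u v : ℤ) : RingOfForm F) = 0 := by
  rw [pow_three']
  ext <;> simp only [RingOfForm.add_x, RingOfForm.add_y, RingOfForm.add_z, RingOfForm.mul_x, RingOfForm.mul_y,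
    RingOfForm.mul_z, RingOfForm.intCast_x, RingOfForm.intCast_y, RingOfForm.intCast_z, RingOfForm.zero_x,
    RingOfForm.zero_y, RingOfForm.zero_z, hessAt, covAt] <;> ring

/-- **The embedding `R(f₀) ↪ R(F)`, `f₀ = (1, 0, −3H, G)`, `(H, G) = (H_F(q), G_F(q))`**: `ω ↦ η_q`,
`θ ↦ 3H − η_q²`; injective as soon as `F(q) ≠ 0` (the index of `ℤ[η_q]` is `27·|F(q)|`). -/
theorem exists_ringHom_of_datum (F : BinaryCubic ℤ) (u v : ℤ) (hq : F.eval u v ≠ 0) :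
    ∃ ψ : RingOfForm (⟨1, 0, -3 * hessAt F u v, covAt F u v⟩ : BinaryCubic ℤ) →+* RingOfForm F,
      Function.Injective ψ := by
  set H : ℤ := hessAt F u v with hHdef
  set G : ℤ := covAt F u v with hGdef
  set η : RingOfForm F := ⟨-(F.b * u - F.c * v), 3 * u, 3 * v⟩ with hηdef
  have hη : η ^ 3 + ((-3 * H : ℤ) : RingOfForm F) * η + ((-G : ℤ) : RingOfForm F) = 0 := eta_charpoly F u v
  obtain ⟨θ', hθ'⟩ : ∃ t : RingOfForm F, t = ((3 * H : ℤ) : RingOfForm F) - η * η := ⟨_, rfl⟩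
  push_cast at hη
  -- the multiplication table of `f₀ = (1, 0, −3H, G)` holds for `(η, θ')`
  have rω2 : η * η = -((1 : RingOfForm F) * (-3 * H : ℤ)) + ((0 : ℤ) : RingOfForm F) * η - ((1 : ℤ) : RingOfForm F) * θ' := by
    rw [hθ']; push_cast; ring
  have rθ2 : θ' * θ' = -(((0 : ℤ) : RingOfForm F) * (G : ℤ)) + ((G : ℤ) : RingOfForm F) * η - ((-3 * H : ℤ) : RingOfForm F) * θ' := by
    rw [hθ']; push_cast; linear_combination η * hη
  have rωθ : η * θ' = -(((1 : ℤ) : RingOfForm F) * (G : ℤ)) := by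
    rw [hθ']; push_cast; linear_combination (-1 : RingOfForm F) * hη
  let f₀ : BinaryCubic ℤ := ⟨1, 0, -3 * H, G⟩
  let ψ : RingOfForm f₀ →+* RingOfForm F :=
    { toFun := fun P => (P.x : RingOfForm F) + (P.y : RingOfForm F) * η + (P.z : RingOfForm F) * θ'
      map_one' := by simp
      map_mul' := by
        intro P Q
        simp only [RingOfForm.mul_x, RingOfForm.mul_y, RingOfForm.mul_z, f₀]
        push_cast
        push_cast at rω2 rθ2 rωθ
        linear_combination (-((P.y : RingOfForm F) * Q.y)) * rω2 + (-((P.z : RingOfForm F) * Q.z)) * rθ2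
          + (-((P.y : RingOfForm F) * Q.z + (P.z : RingOfForm F) * Q.y)) * rωθ
      map_zero' := by simp
      map_add' := by
        intro P Q
        simp only [RingOfForm.add_x, RingOfForm.add_y, RingOfForm.add_z]
        push_cast
        ring }
  have hψ : ∀ P : RingOfForm f₀, ψ P = (P.x : RingOfForm F) + (P.y : RingOfForm F) * η + (P.z : RingOfForm F) * θ' :=
    fun P => rfl
  refine ⟨ψ, fun P Q hPQ => ?_⟩
  have h1 : ψ P - ψ Q = 0 := sub_eq_zero.mpr hPQ
  rw [hψ, hψ] at h1
  set R := P - Q with hR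
  have h0 : ((R.x : ℤ) : RingOfForm F) + (R.y : RingOfForm F) * η + (R.z : RingOfForm F) * θ' = 0 := by
    rw [hR]; simp only [RingOfForm.sub_x, RingOfForm.sub_y, RingOfForm.sub_z]; push_cast
    linear_combination h1
  -- coordinates of `θ'`
  have hθy : θ'.y = -9 * (F.b * u ^ 2 + F.d * v ^ 2) + 6 * (F.b * u - F.c * v) * u := by
    rw [hθ', hηdef]
    simp only [RingOfForm.sub_y, RingOfForm.mul_y, RingOfForm.intCast_y]
    ring
  have hθz : θ'.z = 9 * (F.a * u ^ 2 + F.c * v ^ 2) + 6 * (F.b * u - F.c * v) * v := by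
    rw [hθ', hηdef]
    simp only [RingOfForm.sub_z, RingOfForm.mul_z, RingOfForm.intCast_z]
    ring
  have hx := congrArg RingOfForm.x h0
  have hy := congrArg RingOfForm.y h0
  have hz := congrArg RingOfForm.z h0
  simp only [RingOfForm.add_x, RingOfForm.add_y, RingOfForm.add_z, RingOfForm.mul_x, RingOfForm.mul_y,
    RingOfForm.mul_z, RingOfForm.intCast_x, RingOfForm.intCast_y, RingOfForm.intCast_z, RingOfForm.zero_x,
    RingOfForm.zero_y, RingOfForm.zero_z, hηdef, hθy, hθz] at hx hy hz
  have hRy : R.y * (27 * F.eval u v) = 0 := by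
    simp only [BinaryCubic.eval]
    linear_combination (9 * (F.a * u ^ 2 + F.c * v ^ 2) + 6 * (F.b * u - F.c * v) * v) * hy
      - (-9 * (F.b * u ^ 2 + F.d * v ^ 2) + 6 * (F.b * u - F.c * v) * u) * hz
  have hRy0 : R.y = 0 := (mul_eq_zero.mp hRy).resolve_right (mul_ne_zero (by norm_num) hq)
  have hRz : R.z * (27 * F.eval u v) = 0 := by
    simp only [BinaryCubic.eval]
    linear_combination (-3 * v) * hy + (3 * u) * hz
  have hRz0 : R.z = 0 := (mul_eq_zero.mp hRz).resolve_right (mul_ne_zero (by norm_num) hq)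
  have hRx0 : R.x = 0 := by linear_combination hx - (-(F.b * u - F.c * v)) * hRy0 - θ'.x * hRz0
  refine sub_eq_zero.mp ?_
  rw [← hR]
  ext
  · simpa using hRx0
  · simpa using hRy0
  · simpa using hRz0

/-! ## 3. Fibres of the map `(D, O, q) ↦ (H_F(q), G_F(q))` over maximal orbit representatives -/

/-- `Disc(1, 0, −3H, G) = 27·(4H³ − G²) = 729·Disc F·F(q)²` at `(H, G) = (H_F(q), G_F(q))` (Cayley's syzygy). -/
theorem disc_normalForm_datum (F : BinaryCubic ℤ) (u v : ℤ) :
    (⟨1, 0, -3 * hessAt F u v, covAt F u v⟩ : BinaryCubic ℤ).disc = 729 * F.disc * F.eval u v ^ 2 := by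
  have h := syzygy F u v
  have e : (⟨1, 0, -3 * hessAt F u v, covAt F u v⟩ : BinaryCubic ℤ).disc
      = 108 * hessAt F u v ^ 3 - 27 * covAt F u v ^ 2 := by
    rw [BinaryCubic.disc_eq]; ring
  rw [e]
  linear_combination (-27) * h

/-- **The orbit is determined by `(H_F(q), G_F(q))`**: two MAXIMAL orbit representatives carrying data with
`F(q) ≠ 0` and the same `(H, G)` both receive `R(1, 0, −3H, G)` injectively (`exists_ringHom_of_datum`), hence are
`GL₂(ℤ)`-equivalent (`RingOfForm.gl2zEquiv_of_isMaximal_overrings`), i.e. the same orbit of the same discriminant. -/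
theorem sigma_eq_of_data {D₁ D₂ : ℤ} {O₁ : orbitsOfDisc D₁} {O₂ : orbitsOfDisc D₂}
    (h₁ : RingOfForm.IsMaximal (orbitRep O₁)) (h₂ : RingOfForm.IsMaximal (orbitRep O₂)) {u₁ v₁ u₂ v₂ : ℤ}
    (hq₁ : (orbitRep O₁).eval u₁ v₁ ≠ 0) (hq₂ : (orbitRep O₂).eval u₂ v₂ ≠ 0)
    (hH : hessAt (orbitRep O₁) u₁ v₁ = hessAt (orbitRep O₂) u₂ v₂)
    (hG : covAt (orbitRep O₁) u₁ v₁ = covAt (orbitRep O₂) u₂ v₂) :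
    (⟨D₁, O₁⟩ : Σ D : ℤ, orbitsOfDisc D) = ⟨D₂, O₂⟩ := by
  obtain ⟨ψ₁, hψ₁⟩ := exists_ringHom_of_datum (orbitRep O₁) u₁ v₁ hq₁
  obtain ⟨ψ₂, hψ₂⟩ : ∃ ψ : RingOfForm (⟨1, 0, -3 * hessAt (orbitRep O₁) u₁ v₁, covAt (orbitRep O₁) u₁ v₁⟩ :
      BinaryCubic ℤ) →+* RingOfForm (orbitRep O₂), Function.Injective ψ := by
    rw [hH, hG]; exact exists_ringHom_of_datum (orbitRep O₂) u₂ v₂ hq₂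
  have hdisc : (⟨1, 0, -3 * hessAt (orbitRep O₁) u₁ v₁, covAt (orbitRep O₁) u₁ v₁⟩ : BinaryCubic ℤ).disc ≠ 0 := by
    rw [disc_normalForm_datum]
    exact mul_ne_zero (mul_ne_zero (by norm_num) h₁.disc_ne_zero) (pow_ne_zero 2 hq₁)
  have hequiv : GL2ZEquiv (orbitRep O₁) (orbitRep O₂) :=
    RingOfForm.gl2zEquiv_of_isMaximal_overrings hdisc ψ₁ hψ₁ h₁ ψ₂ hψ₂ h₂
  have hD : D₁ = D₂ := by
    rw [← (orbitRep_spec O₁).2, ← (orbitRep_spec O₂).2]; exact hequiv.disc_eq.symm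
  subst hD
  have hO : O₁.1 = O₂.1 := by
    rw [(orbitRep_spec O₁).1, (orbitRep_spec O₂).1]; exact gl2zOrbit_eq_iff.mpr hequiv
  rw [Subtype.ext hO]

/-- **At most `27` data per ring with given `(H, G)`**: `q ↦ η_q` is injective into the roots of
`T³ − 3H·T − G` in `R(F)` (`eta_charpoly`, `roots_finite_ringOfForm`). -/
theorem ncard_data_le {F : BinaryCubic ℤ} (hF : RingOfForm.IsMaximal F) (H G : ℤ) :
    {q : ℤ × ℤ | hessAt F q.1 q.2 = H ∧ covAt F q.1 q.2 = G}.Finite ∧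
    {q : ℤ × ℤ | hessAt F q.1 q.2 = H ∧ covAt F q.1 q.2 = G}.ncard ≤ 27 := by
  obtain ⟨hfin, h27⟩ := roots_finite_ringOfForm hF (-3 * H) (-G)
  let g : ℤ × ℤ → RingOfForm F := fun q => ⟨-(F.b * q.1 - F.c * q.2), 3 * q.1, 3 * q.2⟩
  have hmaps : ∀ q ∈ {q : ℤ × ℤ | hessAt F q.1 q.2 = H ∧ covAt F q.1 q.2 = G},
      g q ∈ {η : RingOfForm F | η ^ 3 + ((-3 * H : ℤ) : RingOfForm F) * η + ((-G : ℤ) : RingOfForm F) = 0} := by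
    rintro q ⟨hH, hG⟩
    have := eta_charpoly F q.1 q.2
    rw [hH, hG] at this
    exact this
  have hinj : Set.InjOn g {q : ℤ × ℤ | hessAt F q.1 q.2 = H ∧ covAt F q.1 q.2 = G} := by
    intro q _ q' _ h
    have hy := congrArg RingOfForm.y h
    have hz := congrArg RingOfForm.z h
    simp only [g] at hy hz
    exact Prod.ext (by omega) (by omega)
  exact ⟨Set.Finite.of_finite_image (hfin.subset (Set.image_subset_iff.mpr hmaps)) hinj,
    (Set.ncard_le_ncard_of_injOn g hmaps hinj hfin).trans h27⟩

/-- **Registered sub-goal `data_fibre_le`** of stmt-ABC-1975 (stub `stub_ringCensus`): for `F` maximal, at most `27`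
data `q` share given covariant values `(H_F(q), G_F(q)) = (H, G)`. -/
theorem data_fibre_le : ∀ (F : BinaryCubic ℤ), RingOfForm.IsMaximal F → ∀ (H G : ℤ), {q : ℤ × ℤ | hessAt F q.1 q.2 = H ∧ covAt F q.1 q.2 = G}.ncard ≤ 27 :=
  fun _ hF H G => (ncard_data_le hF H G).2

end Summit.ABC.ABC.Theorems.SharpModerateLaw

end
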